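import Mathlib
import Summits.Ventures.PercRepro.PuncturedLYMMixT3Q3Table1
import Summits.Ventures.PercRepro.PuncturedLYMMixT3Q3Table2

/-!
# PercRepro — (SP) FOR `3` PAIRWISE DISJOINT TRIPLES AND `3` PAIRWISE DISJOINT QUADRUPLES AT LEVEL `4`: THE COLUMN IDENTITIES (2)
(p10, gen 41)

For each free column class (`mass ≤ 5`): the rows obtained by removing a point of a member met in `v` points (class `d − e_{s,v} + e_{s,v−1}`, direction code of `(s, v − 1)`) and the `5 − mass` rows obtained by removing a free point carry total weight `1`; the member columns carry `3 · (1/3) = 1` and `4 · (1/4) = 1`.  Nothing here asserts (SP).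
-/

namespace PercRepro.PuncturedLYM.Split.TypeLift.MixT3Q3

/-- The column identity of the free column class `(3, 0, 0, 0, 0)`. -/
theorem col_30000 (n : ℚ) (hd : den n ≠ 0) :
    3 * raw n 2 0 0 0 0 0 + 2 * raw n 3 0 0 0 0 7 = 1 := by
  simp (config := {decide := true}) only [raw, sel, sel_20000, sel_30000, if_true, if_false]
  field_simp
  unfold den N_20000_D30 N_30000_F
  ring

/-- The column identity of the free column class `(3, 0, 0, 1, 0)`. -/
theorem col_30010 (n : ℚ) (hd : den n ≠ 0) :
    3 * raw n 2 0 0 1 0 0 + 2 * raw n 3 0 1 0 0 4 = 1 := by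
  simp (config := {decide := true}) only [raw, sel, sel_20010, sel_30100, if_true, if_false]
  field_simp
  unfold den N_20010_D30 N_30100_D41
  ring

/-- The column identity of the free column class `(3, 0, 1, 0, 0)`. -/
theorem col_30100 (n : ℚ) (hd : den n ≠ 0) :
    3 * raw n 2 0 1 0 0 0 + 1 * raw n 3 0 0 0 0 3 + 1 * raw n 3 0 1 0 0 7 = 1 := by
  simp (config := {decide := true}) only [raw, sel, sel_20100, sel_30000, sel_30100, if_true, if_false]
  field_simp
  unfold den N_20100_D30 N_30000_D40 N_30100_F
  ring

/-- The column identity of the free column class `(3, 0, 2, 0, 0)`. -/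
theorem col_30200 (n : ℚ) (hd : den n ≠ 0) :
    3 * raw n 2 0 2 0 0 0 + 2 * raw n 3 0 1 0 0 3 = 1 := by
  simp (config := {decide := true}) only [raw, sel, sel_20200, sel_30100, if_true, if_false]
  field_simp
  unfold den N_20200_D30 N_30100_D40
  ring

end PercRepro.PuncturedLYM.Split.TypeLift.MixT3Q3
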